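import Literature.NumberTheory.ComplexMultiplication.CMGaloisSubfield
import HarnessLib

/-!
# Dodson's fields: for every `n ≥ 1` an abelian CM field `K` with `Gal(K/ℚ) = ⟨ρ⟩ × ℤ/n`
# (a cyclic totally real field of degree `n` composed with an imaginary quadratic field), inside `ℚ(ζ_{4q})`

B. Dodson, *The structure of Galois groups of CM-fields*, Trans. AMS **283** (1984) [Dodson1984], proof of the
Theorem of §3.2.1 (A Converse of Ribet's Theorem), p. 13: "Observe that there exist cyclic totally real fields for
every `n`, so there exist CM-fields `K` with `K/ℚ` Abelian and `Gal(K/ℚ) = ⟨ρ⟩ × ℤₙ = G`."  The standard source of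
cyclic (totally real) fields of every degree is a subfield of a cyclotomic field `ℚ(ζ_q)`, `q ≡ 1 (mod n)` prime
(Dirichlet; [Washington1997] Thm. 2.5: `Gal(ℚ(ζ_m)/ℚ) ≅ (ℤ/m)ˣ`, and Ch. 2: every subfield of `ℚ(ζ_m)` is abelian).

PROVED here (`exists_abelianCMField_gal_cyclicTimesConj`): for every `n ≥ 1` there is a CM number field `K`, Galois
over `ℚ` with COMMUTATIVE Galois group, an element `σ ∈ Gal(K/ℚ)` of order `n`, the complex conjugation
`ρ ∈ Gal(K/ℚ)` (`φ₀ ∘ ρ = conj ∘ φ₀`) with `ρ ∉ ⟨σ⟩`, and `[K : ℚ] = 2n` — so that `Gal(K/ℚ) = ⟨ρ⟩ × ⟨σ⟩ ≅ ℤ/2 × ℤ/n`,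
exactly the hypotheses of the companion files `DegenerateCMTypesCompositeDimension(Rank)` and
`AlgebraicGeometry/Pohlmann1968/SimpleDegenerateCMAbelianVarietiesCompositeDimension`.

Construction (all inside `L = ℚ(ζ_{4q})`, `q` a prime with `q ≡ 1 (mod n)`, `q > 2`, Mathlib's
`Nat.exists_prime_gt_modEq_one`): `Gal(L/ℚ) ≅ (ℤ/4q)ˣ` (`IsCyclotomicExtension.autEquivPow`); by the Chinese remainder
theorem pick `u₀ ∈ (ℤ/4q)ˣ` with `u₀ ≡ 1 (mod 4)` and `u₀ ≡ g (mod q)`, `g` a generator of `(ℤ/q)ˣ`, so `u₀` has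
order `q − 1`; let `γ ↔ u₀` and `H = ⟨γⁿ⟩` (order `(q−1)/n`), `K = L^H`.  Then `[K : ℚ] = 2(q−1)/((q−1)/n) = 2n`,
`σ = γ|_K` has order `n`, and complex conjugation `c ↔ −1` is NOT in `⟨γ⟩H` because every element there is
`≡ 1 (mod 4)` while `−1 ≢ 1 (mod 4)`; in particular `ρ = c|_K ≠ 1` (so `K` is CM, tree `CMGaloisSubfield`) and
`ρ ∉ ⟨σ⟩`.  Theorems only; no definition, no named fact.

## References

* [Dodson1984] B. Dodson, Trans. AMS 283 (1984), §3.2.1 Theorem (proof), p. 13.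
* [Washington1997] L. C. Washington, *Introduction to Cyclotomic Fields*, Thm. 2.5 and Ch. 2.
-/

set_option autoImplicit false

noncomputable section

namespace Literature.NumberTheory.ComplexMultiplication

namespace Dodson1984

open NumberField IntermediateField Polynomial

/-! ### §1 Powers in a cyclic group: `γⁱ ∈ ⟨γⁿ⟩ ↔ n ∣ i` -/

/-- For `γ` of finite order `N` with `n ∣ N`: `γⁱ ∈ ⟨γⁿ⟩ ↔ n ∣ i`. [folklore] -/
private theorem pow_mem_zpowers_pow_iff {G : Type*} [Group G] {γ : G} {N n : ℕ} (hN : orderOf γ = N)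
    (hnN : n ∣ N) (i : ℕ) : γ ^ i ∈ Subgroup.zpowers (γ ^ n) ↔ n ∣ i := by
  constructor
  · intro h
    obtain ⟨k, hk⟩ := Subgroup.mem_zpowers_iff.1 h
    rw [← zpow_natCast, ← zpow_natCast, ← zpow_mul, zpow_eq_zpow_iff_modEq, hN] at hk
    -- `n k ≡ i (mod N)` with `n ∣ N`
    have h1 : (n : ℤ) ∣ (i : ℤ) := by
      have h2 := (Int.ModEq.dvd hk)   -- (N : ℤ) ∣ i - n*k
      have h3 : (n : ℤ) ∣ (i : ℤ) - (n : ℤ) * k := (Int.natCast_dvd_natCast.2 hnN).trans h2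
      have h4 : (n : ℤ) ∣ (n : ℤ) * k := dvd_mul_right _ _
      simpa using (Int.dvd_add h3 h4)
    exact Int.natCast_dvd_natCast.1 h1
  · rintro ⟨j, rfl⟩
    rw [pow_mul]
    exact Subgroup.pow_mem _ (Subgroup.mem_zpowers _) j

/-! ### §2 Units modulo `4q`: an element `≡ 1 (mod 4)` of order `q − 1` -/

section Units

variable {q : ℕ} [hq : Fact q.Prime]

/-- `4` and an odd prime `q` are coprime. [folklore] -/
private theorem coprime_four (hq2 : 2 < q) : Nat.Coprime 4 q := by
  have h : ¬ q ∣ 4 := fun h => by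
    have := Nat.le_of_dvd (by norm_num) h
    interval_cases q <;> simp_all (config := { decide := true })
  exact (Nat.Coprime.symm ((Nat.Prime.coprime_iff_not_dvd hq.out).2 h))

/-- **CRT bookkeeping**: for `q` an odd prime there is a unit `u₀ ∈ (ℤ/4q)ˣ` with `u₀ ≡ 1 (mod 4)` and of order
exactly `q − 1`, and the reductions `mod 4` and `mod q` are jointly injective on `(ℤ/4q)ˣ`. [folklore] -/
private theorem exists_unit_mod_four_eq_one_orderOf (hq2 : 2 < q) :
    ∃ u₀ : (ZMod (4 * q))ˣ, ZMod.unitsMap (dvd_mul_right 4 q) u₀ = 1 ∧ orderOf u₀ = q - 1 := by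
  have hcop : Nat.Coprime 4 q := coprime_four hq2
  haveI : NeZero (4 * q) := ⟨by positivity⟩
  -- a generator of `(ℤ/q)ˣ`, of order `q − 1`
  obtain ⟨g, hg⟩ := IsCyclic.exists_generator (α := (ZMod q)ˣ)
  have hordg : orderOf g = q - 1 := by
    rw [orderOf_eq_card_of_forall_mem_zpowers hg, Nat.card_eq_fintype_card, ZMod.card_units_eq_totient,
      Nat.totient_prime hq.out]
  -- CRT
  let e : ZMod (4 * q) ≃+* ZMod 4 × ZMod q := ZMod.chineseRemainder hcop
  have he : ∀ x : ZMod (4 * q), e x = (ZMod.cast x : ZMod 4 × ZMod q) := fun x => rfl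
  have he1 : ∀ x : ZMod (4 * q), (e x).1 = (ZMod.castHom (dvd_mul_right 4 q) (ZMod 4)) x := fun x => by
    rw [he, Prod.fst_zmod_cast, ZMod.castHom_apply]
  have he2 : ∀ x : ZMod (4 * q), (e x).2 = (ZMod.castHom (dvd_mul_left q 4) (ZMod q)) x := fun x => by
    rw [he, Prod.snd_zmod_cast, ZMod.castHom_apply]
  set x : ZMod (4 * q) := e.symm (1, (g : ZMod q)) with hx
  set y : ZMod (4 * q) := e.symm (1, ((g⁻¹ : (ZMod q)ˣ) : ZMod q)) with hy
  have hxy : x * y = 1 := e.injective (by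
    rw [map_mul, map_one, hx, hy, e.apply_symm_apply, e.apply_symm_apply, Prod.mk_mul_mk, one_mul,
      Units.mul_inv, Prod.mk_one_one])
  let u₀ : (ZMod (4 * q))ˣ := Units.mkOfMulEqOne x y hxy
  have hu₀ : (u₀ : ZMod (4 * q)) = x := rfl
  have hx1 : (ZMod.castHom (dvd_mul_right 4 q) (ZMod 4)) x = 1 := by
    rw [← he1, hx, e.apply_symm_apply]
  have hx2 : (ZMod.castHom (dvd_mul_left q 4) (ZMod q)) x = g := by
    rw [← he2, hx, e.apply_symm_apply]
  have h4 : ZMod.unitsMap (dvd_mul_right 4 q) u₀ = 1 :=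
    Units.ext (by rw [ZMod.unitsMap_def, Units.coe_map, MonoidHom.coe_coe, hu₀, hx1, Units.val_one])
  have hq' : ZMod.unitsMap (dvd_mul_left q 4) u₀ = g :=
    Units.ext (by rw [ZMod.unitsMap_def, Units.coe_map, MonoidHom.coe_coe, hu₀, hx2])
  -- joint injectivity of the two reductions on units
  have hinj : ∀ v w : (ZMod (4 * q))ˣ, ZMod.unitsMap (dvd_mul_right 4 q) v = ZMod.unitsMap (dvd_mul_right 4 q) w →
      ZMod.unitsMap (dvd_mul_left q 4) v = ZMod.unitsMap (dvd_mul_left q 4) w → v = w := by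
    intro v w h1 h2
    apply Units.ext
    apply e.injective
    refine Prod.ext ?_ ?_
    · rw [he1, he1]
      have := congrArg (fun u : (ZMod 4)ˣ => (u : ZMod 4)) h1
      simpa [ZMod.unitsMap_def] using this
    · rw [he2, he2]
      have := congrArg (fun u : (ZMod q)ˣ => (u : ZMod q)) h2
      simpa [ZMod.unitsMap_def] using this
  refine ⟨u₀, h4, Nat.dvd_antisymm ?_ ?_⟩
  · -- `u₀^(q-1) = 1`
    refine orderOf_dvd_of_pow_eq_one (hinj _ _ ?_ ?_)
    · rw [map_pow, h4, one_pow, map_one]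
    · rw [map_pow, hq', ← hordg, pow_orderOf_eq_one, map_one]
  · -- `q - 1 = orderOf g ∣ orderOf u₀`
    rw [← hordg, ← hq']
    exact orderOf_map_dvd _ u₀

end Units

/-! ### §3 The cyclotomic field `ℚ(ζ_m)`: Galois group, complex conjugation `↔ −1` -/

section Cyclotomic

/-- The cyclotomic polynomial `Φ_m` is irreducible over `ℚ`. [cite: Washington1997, Thm. 2.5] -/
private theorem irr (m : ℕ) [NeZero m] : Irreducible (cyclotomic m ℚ) := cyclotomic.irreducible_rat (NeZero.pos m)

/-- `Gal(ℚ(ζ_m)/ℚ)` is commutative (`≅ (ℤ/m)ˣ`). [cite: Washington1997, Thm. 2.5] -/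
private theorem gal_comm (m : ℕ) [NeZero m] (L : Type) [Field L] [NumberField L] [IsCyclotomicExtension {m} ℚ L]
    (f g : L ≃ₐ[ℚ] L) : f * g = g * f :=
  (IsCyclotomicExtension.autEquivPow L (irr m)).injective (by rw [map_mul, map_mul, mul_comm])

/-- **Complex conjugation is `−1 ∈ (ℤ/m)ˣ`**: under `Gal(ℚ(ζ_m)/ℚ) ≅ (ℤ/m)ˣ` the complex conjugation `conjGal` of
the CM field `ℚ(ζ_m)` maps to `−1` (`ζ̄ = ζ⁻¹`). [cite: Washington1997, Thm. 2.5] -/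
private theorem autEquivPow_conjGal (m : ℕ) [NeZero m] (L : Type) [Field L] [NumberField L]
    [IsCyclotomicExtension {m} ℚ L] [IsCMField L] :
    IsCyclotomicExtension.autEquivPow L (irr m) (conjGal : L ≃ₐ[ℚ] L) = -1 := by
  set ζ := IsCyclotomicExtension.zeta m ℚ L with hζ
  have hζ' : IsPrimitiveRoot ζ m := IsCyclotomicExtension.zeta_spec m ℚ L
  -- `conjGal ζ = ζ⁻¹`
  obtain ⟨φ⟩ := (inferInstance : Nonempty (L →+* ℂ))
  have hnorm : ‖φ ζ‖ = 1 :=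
    Complex.norm_eq_one_of_pow_eq_one (by rw [← map_pow, hζ'.pow_eq_one, map_one]) (NeZero.ne m)
  have hconj : (conjGal : L ≃ₐ[ℚ] L) ζ = ζ⁻¹ := by
    apply φ.injective
    rw [conjGal_apply, IsCMField.complexEmbedding_complexConj, map_inv₀, Complex.inv_eq_conj hnorm]
  -- read off the exponent `a`: `ζ^a = ζ⁻¹`, so `ζ^(a+1) = 1`, `m ∣ a + 1`, `a = -1`
  set u : (ZMod m)ˣ := IsCyclotomicExtension.autEquivPow L (irr m) (conjGal : L ≃ₐ[ℚ] L) with hu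
  have hspec : ζ ^ (u : ZMod m).val = (conjGal : L ≃ₐ[ℚ] L) ζ := by
    rw [hu, IsCyclotomicExtension.autEquivPow_apply]
    exact hζ'.autToPow_spec ℚ _
  rw [hconj] at hspec
  have hpow : ζ ^ ((u : ZMod m).val + 1) = 1 := by
    rw [pow_succ, hspec, inv_mul_cancel₀ (hζ'.ne_zero (NeZero.ne m))]
  have hdvd : m ∣ (u : ZMod m).val + 1 := (hζ'.pow_eq_one_iff_dvd _).1 hpow
  have hcast : ((u : ZMod m) + 1 : ZMod m) = 0 := by
    have h := (ZMod.natCast_eq_zero_iff _ m).2 hdvd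
    rwa [Nat.cast_add, Nat.cast_one, ZMod.natCast_zmod_val] at h
  exact Units.ext (by rw [Units.val_neg, Units.val_one]; exact eq_neg_of_add_eq_zero_left hcast)

/-- A homomorphism into a group which is trivial on `γ` is trivial on `⟨γⁿ⟩`. [folklore] -/
private theorem map_eq_one_of_mem_zpowers_pow {G M : Type*} [Group G] [Group M] (ψ : G →* M) {γ : G}
    (hγ : ψ γ = 1) {n : ℕ} {h : G} (hh : h ∈ Subgroup.zpowers (γ ^ n)) : ψ h = 1 := by
  obtain ⟨k, rfl⟩ := Subgroup.mem_zpowers_iff.1 hh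
  rw [map_zpow, map_pow, hγ, one_pow, one_zpow]

end Cyclotomic

/-! ### §4 Dodson's fields `K ⊆ ℚ(ζ_{4q})` -/

section Main

/-- **The construction inside `ℚ(ζ_{4q})`.**  For a prime `q > 2` and `0 < n ∣ q − 1`, the cyclotomic field
`L = ℚ(ζ_{4q})` contains a subfield `K`, Galois over `ℚ` with commutative group, which is a CM field of degree `2n`
whose Galois group contains an element `σ` of order `n` with the complex conjugation `ρ ∉ ⟨σ⟩`.
[cite: Dodson1984, §3.2.1 Theorem (proof)] [cite: Washington1997, Thm. 2.5] -/
theorem exists_subfield_cyclotomic {n q : ℕ} [hq : Fact q.Prime] (hq2 : 2 < q) (hn : 0 < n)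
    (hnq : n ∣ q - 1) (L : Type) [Field L] [NumberField L] [IsCyclotomicExtension {4 * q} ℚ L] :
    ∃ (K : IntermediateField ℚ L) (_ : IsGalois ℚ K) (_ : IsCMField K) (ρ σ : K ≃ₐ[ℚ] K) (φ₀ : K →+* ℂ),
      (∀ g h : K ≃ₐ[ℚ] K, g * h = h * g) ∧ (∀ x, φ₀ (ρ x) = starRingEnd ℂ (φ₀ x)) ∧ orderOf σ = n ∧
        ρ ∉ Subgroup.zpowers σ ∧ Module.finrank ℚ K = 2 * n := by
  classical
  haveI : NeZero (4 * q) := ⟨by positivity⟩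
  haveI : IsGalois ℚ L := IsCyclotomicExtension.isGalois {4 * q} ℚ L
  haveI : IsCMField L := IsCyclotomicExtension.Rat.isCMField L (S := {4 * q}) ⟨4 * q, rfl, by omega⟩
  set e := IsCyclotomicExtension.autEquivPow L (irr (4 * q)) with he
  have hcommL : ∀ f g : L ≃ₐ[ℚ] L, f * g = g * f := gal_comm (4 * q) L
  -- the unit `u₀ ≡ 1 (mod 4)` of order `q − 1` and `γ ↔ u₀`
  obtain ⟨u₀, hu4, hord⟩ := exists_unit_mod_four_eq_one_orderOf (q := q) hq2
  set γ : L ≃ₐ[ℚ] L := e.symm u₀ with hγ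
  have heγ : e γ = u₀ := e.apply_symm_apply u₀
  have hordγ : orderOf γ = q - 1 := by
    rw [← hord, ← heγ]
    exact (orderOf_injective e.toMonoidHom e.injective γ).symm
  -- `H = ⟨γⁿ⟩`, `K = L^H`
  set H : Subgroup (L ≃ₐ[ℚ] L) := Subgroup.zpowers (γ ^ n) with hH
  haveI hHn : H.Normal := ⟨fun a ha b => by rwa [hcommL b a, mul_inv_cancel_right]⟩
  set K : IntermediateField ℚ L := IntermediateField.fixedField H with hK
  haveI hKgal : IsGalois ℚ K := IsGalois.of_fixedField_normal_subgroup H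
  -- the `mod 4` character `ψ = (mod 4) ∘ e`: trivial on `γ` and on `H`, `ψ(conj) = −1 ≠ 1`
  set ψ : (L ≃ₐ[ℚ] L) →* (ZMod 4)ˣ := (ZMod.unitsMap (dvd_mul_right 4 q)).comp e.toMonoidHom with hψ
  have hψγ : ψ γ = 1 := by
    rw [hψ, MonoidHom.comp_apply, MulEquiv.coe_toMonoidHom, heγ, hu4]
  have hψH : ∀ h ∈ H, ψ h = 1 := fun h hh => map_eq_one_of_mem_zpowers_pow ψ hψγ hh
  have hψc : ψ (conjGal : L ≃ₐ[ℚ] L) ≠ 1 := by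
    rw [hψ, MonoidHom.comp_apply, MulEquiv.coe_toMonoidHom, autEquivPow_conjGal (4 * q) L]
    intro h1
    have h2 := congrArg (fun u : (ZMod 4)ˣ => (u : ZMod 4)) h1
    simp only [ZMod.unitsMap_def, Units.coe_map, MonoidHom.coe_coe, Units.val_neg, Units.val_one, map_neg,
      map_one] at h2
    revert h2
    decide
  have hcH : (conjGal : L ≃ₐ[ℚ] L) ∉ H := fun h => hψc (hψH _ h)
  -- the kernel of restriction to `K` is `H`
  have hkerEq : (AlgEquiv.restrictNormalHom K).ker = H := by
    have h1 := IntermediateField.restrictNormalHom_ker K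
    have h2 : K.fixingSubgroup = H := by rw [hK, IntermediateField.fixingSubgroup_fixedField]
    rw [h2] at h1
    exact h1
  have hker : ∀ f : L ≃ₐ[ℚ] L, AlgEquiv.restrictNormalHom K f = 1 ↔ f ∈ H := fun f => by
    rw [← MonoidHom.mem_ker, hkerEq]
  -- `ρ = conj|_K`, `σ = γ|_K`
  have hres : AlgEquiv.restrictNormalHom K (conjGal : L ≃ₐ[ℚ] L) = conjGalRestrict K := by
    apply AlgEquiv.ext
    intro x
    apply Subtype.ext
    rw [coe_conjGalRestrict_apply]
    exact AlgEquiv.restrictNormal_commutes (conjGal : L ≃ₐ[ℚ] L) K x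
  have hρ1 : conjGalRestrict K ≠ 1 := fun h1 => hcH ((hker _).1 (hres.trans h1))
  haveI hKcm : IsCMField K := isCMField_of_conjGalRestrict_ne_one K hρ1
  set σ : K ≃ₐ[ℚ] K := AlgEquiv.restrictNormalHom K γ with hσ
  have hσpow : ∀ i : ℕ, σ ^ i = 1 ↔ n ∣ i := fun i => by
    rw [hσ, ← map_pow, hker, hH, pow_mem_zpowers_pow_iff hordγ hnq]
  have hordσ : orderOf σ = n := by
    rw [orderOf_eq_iff hn]
    refine ⟨(hσpow n).2 dvd_rfl, fun m hm hm0 h => ?_⟩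
    exact absurd (Nat.le_of_dvd hm0 ((hσpow m).1 h)) (not_le.2 hm)
  -- `ρ ∉ ⟨σ⟩`
  have hρσ : conjGalRestrict K ∉ Subgroup.zpowers σ := by
    intro hmem
    obtain ⟨i, hi⟩ := (mem_powers_iff_mem_zpowers.2 hmem)
    dsimp only at hi
    rw [hσ, ← map_pow, ← hres] at hi
    have h1 : AlgEquiv.restrictNormalHom K (γ ^ i * (conjGal : L ≃ₐ[ℚ] L)⁻¹) = 1 := by
      rw [map_mul, map_inv, hi, mul_inv_cancel]
    have h2 := hψH _ ((hker _).1 h1)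
    rw [map_mul, map_inv, map_pow, hψγ, one_pow, one_mul, inv_eq_one] at h2
    exact hψc h2
  -- commutativity of `Gal(K/ℚ)`
  have hcommK : ∀ g h : K ≃ₐ[ℚ] K, g * h = h * g := fun g h => by
    obtain ⟨g', rfl⟩ := AlgEquiv.restrictNormalHom_surjective L g
    obtain ⟨h', rfl⟩ := AlgEquiv.restrictNormalHom_surjective L h
    rw [← map_mul, ← map_mul, hcommL]
  -- the degree: `[L:ℚ] = φ(4q) = 2(q−1)`, `[L:K] = |H| = (q−1)/n`
  have hfin : Module.finrank ℚ K = 2 * n := by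
    have hL : Module.finrank ℚ L = 2 * (q - 1) := by
      rw [IsCyclotomicExtension.finrank L (irr (4 * q)), Nat.totient_mul (coprime_four hq2),
        Nat.totient_prime hq.out, show Nat.totient 4 = 2 by decide]
    have hKL : Module.finrank K L = (q - 1) / n := by
      rw [hK, IntermediateField.finrank_fixedField_eq_card, hH, Nat.card_zpowers,
        orderOf_pow_of_dvd hn.ne' (hordγ ▸ hnq), hordγ]
    have htower := Module.finrank_mul_finrank ℚ K L
    rw [hL, hKL] at htower
    obtain ⟨t, ht⟩ := hnq
    have ht0 : 0 < t := by
      rcases Nat.eq_zero_or_pos t with h | h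
      · rw [h, mul_zero] at ht; omega
      · exact h
    rw [ht, Nat.mul_div_cancel_left _ hn] at htower
    -- `finrank K * t = 2 * (n * t)`
    have : Module.finrank ℚ K * t = (2 * n) * t := by rw [htower]; ring
    exact Nat.eq_of_mul_eq_mul_right ht0 this
  -- an embedding and the conjugation relation
  obtain ⟨φ₀⟩ := (inferInstance : Nonempty (K →+* ℂ))
  have hρ : ∀ x, φ₀ (conjGalRestrict K x) = starRingEnd ℂ (φ₀ x) := fun x => by
    rw [(isConj_conjGalRestrict K φ₀).eq x]
    rfl
  exact ⟨K, hKgal, hKcm, conjGalRestrict K, σ, φ₀, hcommK, hρ, hordσ, hρσ, hfin⟩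

/-- **Dodson's fields exist in every degree** ("there exist cyclic totally real fields for every `n`, so there exist
CM-fields `K` with `K/ℚ` Abelian and `Gal(K/ℚ) = ⟨ρ⟩ × ℤₙ`"): for every `n ≥ 1` a CM number field `K`, Galois over
`ℚ` with commutative Galois group containing an element `σ` of order `n` and the complex conjugation `ρ`
(`φ₀ ∘ ρ = conj ∘ φ₀`) with `ρ ∉ ⟨σ⟩`, and `[K : ℚ] = 2n` — realised inside `ℚ(ζ_{4q})` for a prime `q ≡ 1 (mod n)`
(Dirichlet, Mathlib `Nat.exists_prime_gt_modEq_one`). [cite: Dodson1984, §3.2.1 Theorem (proof)]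
[cite: Washington1997, Thm. 2.5] -/
theorem exists_abelianCMField_gal_cyclicTimesConj (n : ℕ) (hn : 0 < n) :
    ∃ (K : Type) (_ : Field K) (_ : NumberField K) (_ : IsCMField K) (_ : IsGalois ℚ K)
      (ρ σ : K ≃ₐ[ℚ] K) (φ₀ : K →+* ℂ),
      (∀ g h : K ≃ₐ[ℚ] K, g * h = h * g) ∧ (∀ x, φ₀ (ρ x) = starRingEnd ℂ (φ₀ x)) ∧ orderOf σ = n ∧
        ρ ∉ Subgroup.zpowers σ ∧ Module.finrank ℚ K = 2 * n := by
  obtain ⟨q, hqprime, hq2, hqn⟩ := Nat.exists_prime_gt_modEq_one 2 hn.ne'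
  haveI : Fact q.Prime := ⟨hqprime⟩
  have hnq : n ∣ q - 1 := (Nat.modEq_iff_dvd' (by omega)).1 hqn.symm
  haveI : NeZero (4 * q) := ⟨by positivity⟩
  haveI : IsCyclotomicExtension {4 * q} ℚ (CyclotomicField (4 * q) ℚ) :=
    CyclotomicField.isCyclotomicExtension (4 * q) ℚ
  haveI : NumberField (CyclotomicField (4 * q) ℚ) := IsCyclotomicExtension.numberField {4 * q} ℚ _
  obtain ⟨K, hgal, hcm, ρ, σ, φ₀, h⟩ := exists_subfield_cyclotomic hq2 hn hnq (CyclotomicField (4 * q) ℚ)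
  haveI : NumberField K := inferInstance
  exact ⟨K, inferInstance, inferInstance, hcm, hgal, ρ, σ, φ₀, h⟩

end Main

end Dodson1984

end Literature.NumberTheory.ComplexMultiplication

end
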